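import Summits.Ventures.HSemireg.WedgeHankelOuterValue
import Summits.Ventures.HSemireg.WedgeHankelPairMixingPermutation

/-!
# Venture HSemireg — THE VALUE FOR EVERY PAIR SET: `dim (Kr(univ, w_N q, k) ⊓ Sp(pairs ⊆ T)) = C(2|T|, k) − C(|T|, k) · rank H_k(q)` for every `T ⊆ [N]`, every `k`, every `q`,
# every field — Gen 20/21 OPEN (c) closed

HONEST FRAMING. Part of the Lean index of the computation cell `pub-hsemireg` (seat p10 gen 22, Sunday typer «UNIFORM-IN-n»).
Finite-dimensional EXTERIOR ALGEBRA over a field ONLY: no variety, no cohomology theory, no sheaf, no Ext group, no semiregularity map;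
nothing here says that HC / HC_CM / HC_AV holds; no Literature fact is declared or used.  Custodian versions as in `WedgeHankelSiegelIdeal` (1/3); the dictionary (`w_N(q)` = the
class of the box on `N` pairs; `Sp(pairs ⊆ T)` = the forms on the sub-product of the pairs in `T`; `H_k(q)` = the `k`-th Hankel matrix of the coefficient sequence) is QUOTED,
never asserted.

WHAT IS IN THE TREE.  `Sp`, `mem_Sp_iff`, `Hom_eq_Sp` (`WedgeWeilSpan`), the pair index `pr` (`WedgeWeilPairs`), K25 (this seat, `WedgeHankelPairMixingPermutation`):
`finrank_Kr_w_inf_Sp_pairs_eq_of_card_eq` (`dim (Kr(univ, w_N q, k) ⊓ Sp(pairs ⊆ T))` depends on `|T|` only), K39 (this seat, `WedgeHankelOuterValue`): `finrank_Kr_w_Dm_add`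
(`dim Kr K (Dm M) (w_N q) k + C(M,k) · rank H_k(q) = C(2M, k)`).  THIS FILE (namespace `Summit.Ventures.HSemireg.Wedge.HankelOuter`, continued; imports K39 and K25):
* §360 `Sp_inf_Sp` (`Sp P ⊓ Sp Q = Sp (P ∧ Q)`, read off the coordinates), `Sp_congr_iff`, `pr_lt_iff_mem_Dm` (`pr i < M ↔ i ∈ Dm M`),
  **`Kr_univ_inf_Sp_pairs_lt_eq`: `Kr K univ f k ⊓ Sp(pairs < M) = Kr K (Dm M) f k`** (any class `f`): the forms of the sub-box of the first `M` pairs ARE th-7's block `Dm M`.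
* §361 **`finrank_Kr_w_inf_Sp_pairs_add`: `dim (Kr K univ (w K N N q) k ⊓ Sp K (pairs ⊆ T)) + C(|T|, k) · rank (hankel1 K N k q) = C(|T| + |T|, k)` for EVERY `T : Finset (Fin N)`,
  every `k`, every `q`, every field** (K25 moves `T` to the first `|T|` pairs, §360 identifies that with `Dm |T|`, K39 gives the value); `finrank_Kr_w_inf_Sp_pairs_eq` (subtraction
  form); `finrank_Kr_w_inf_Sp_pairs_of_card_lt` (`|T| < k`: every such form dies, `dim = C(2|T|, k)`).
READING: on the `k`-forms of ANY sub-box of `M` pairs, th-7's class has kernel codimension `C(M, k) · r_k(q)` — the full box's Hankel rank `r_k(q)` with multiplicity `C(M,k)`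
(th-7: `C(N,k)` on all forms).  Nothing Ext-side.  New names only.
-/

open Module

namespace Summit.Ventures.HSemireg.Wedge.HankelOuter

open Summit.Ventures.HSemireg.Wedge Summit.Ventures.HSemireg.Wedge.Kunneth Summit.Ventures.HSemireg.Wedge.Hankel
  Summit.Ventures.HSemireg.Wedge.BasisFree Summit.Ventures.HSemireg.Wedge.HankelSiegel Summit.Ventures.HSemireg.Wedge.HankelSiegelIdeal
  Summit.Ventures.HSemireg.Wedge.KunnethKernel Summit.Ventures.HSemireg.Wedge.HankelFrameChange Summit.Ventures.HSemireg.Wedge.Weil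
  Summit.Ventures.HSemireg.Wedge.HankelPairMixing

variable (K : Type*) [Field K] {N : ℕ}

/-! ## §360. The forms of the sub-box of the first `M` pairs are th-7's block `Dm M` -/

/-- `Sp P ⊓ Sp Q = Sp (P ∧ Q)` (membership in an `Sp` is read off the coordinates). -/
theorem Sp_inf_Sp (P Q : Finset (In N) → Prop) : Sp K P ⊓ Sp K Q = Sp K (fun s => P s ∧ Q s) := by
  ext v
  rw [Submodule.mem_inf, mem_Sp_iff, mem_Sp_iff, mem_Sp_iff]
  exact ⟨fun h t ht => ⟨h.1 t ht, h.2 t ht⟩, fun h => ⟨fun t ht => (h t ht).1, fun t ht => (h t ht).2⟩⟩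

/-- `Sp` only depends on the extension of the predicate. -/
theorem Sp_congr_iff {P Q : Finset (In N) → Prop} (h : ∀ s, P s ↔ Q s) : Sp K P = Sp K Q :=
  le_antisymm (Sp_mono fun s hs => (h s).mp hs) (Sp_mono fun s hs => (h s).mpr hs)

/-- `pr i < M ↔ i ∈ Dm M`: a generator belongs to one of the first `M` pairs iff it is one of th-7's first `2M` generators (any `M`; for `M > N` both say `True`). -/
theorem pr_lt_iff_mem_Dm (M : ℕ) (i : In N) : ((pr i : Fin N) : ℕ) < M ↔ i ∈ Dm N M := by
  unfold pr
  simp only [Dm, Finset.mem_filter, Finset.mem_univ, true_and]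
  have hi := i.2
  split_ifs with h
  · dsimp only
    omega
  · dsimp only
    omega

/-- **`Kr K univ f k ⊓ Sp(pairs < M) = Kr K (Dm M) f k`** (any `M`, any class `f`, any degree): the `k`-forms all of whose letters lie in the first `M` pairs are exactly th-7's
`Hom(Dm M, k)`, so the restricted kernel of K25/J6 is th-7's block kernel space. -/
theorem Kr_univ_inf_Sp_pairs_lt_eq (M : ℕ) (f : HT K (In N)) (k : ℕ) :
    Kr K (Finset.univ : Finset (In N)) f k ⊓ Sp K (fun s : Finset (In N) => ∀ i ∈ s, ((pr i : Fin N) : ℕ) < M) = Kr K (Dm N M) f k := by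
  rw [Kr, Kr, inf_right_comm, Hom_eq_Sp, Hom_eq_Sp, Sp_inf_Sp]
  congr 1
  apply Sp_congr_iff
  intro s
  constructor
  · rintro ⟨⟨-, hc⟩, hp⟩
    exact ⟨fun i hi => (pr_lt_iff_mem_Dm M i).mp (hp i hi), hc⟩
  · rintro ⟨hs, hc⟩
    exact ⟨⟨Finset.subset_univ _, hc⟩, fun i hi => (pr_lt_iff_mem_Dm M i).mpr (hs hi)⟩

/-! ## §361. The value for every pair set -/

/-- **THE VALUE FOR EVERY PAIR SET: `dim (Kr K univ (w K N N q) k ⊓ Sp K (pairs ⊆ T)) + C(|T|, k) · rank (hankel1 K N k q) = C(|T| + |T|, k)`** — for every `T : Finset (Fin N)`,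
every degree `k`, every sequence `q` and every field: on the `k`-forms of the sub-box of the pairs in `T` the kernel of th-7's class has codimension `C(|T|, k) · r_k(q)`, `r_k(q)`
the `k`-th Hankel rank of the FULL box (K25: only `|T|` matters; §360: the first `|T|` pairs are th-7's block `Dm |T|`; K39: the value there). -/
theorem finrank_Kr_w_inf_Sp_pairs_add (T : Finset (Fin N)) (k : ℕ) (q : ℕ → K) :
    finrank K ↥(Kr K (Finset.univ : Finset (In N)) (w K N N q) k ⊓ Sp K (fun s : Finset (In N) => ∀ i ∈ s, pr i ∈ T))
      + T.card.choose k * (hankel1 K N k q).rank = (T.card + T.card).choose k := by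
  have hM : T.card ≤ N := by
    have h := Finset.card_le_univ T
    rwa [Fintype.card_fin] at h
  let T₀ : Finset (Fin N) := (Finset.range T.card).attachFin fun m hm => lt_of_lt_of_le (Finset.mem_range.mp hm) hM
  have hT₀ : T.card = T₀.card := by rw [Finset.card_attachFin, Finset.card_range]
  rw [finrank_Kr_w_inf_Sp_pairs_eq_of_card_eq K q k hT₀]
  have hSp : Sp K (fun s : Finset (In N) => ∀ i ∈ s, pr i ∈ T₀) = Sp K (fun s : Finset (In N) => ∀ i ∈ s, ((pr i : Fin N) : ℕ) < T.card) := by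
    apply Sp_congr_iff
    intro s
    refine forall₂_congr fun i _ => ?_
    rw [Finset.mem_attachFin, Finset.mem_range]
  rw [hSp, Kr_univ_inf_Sp_pairs_lt_eq K T.card]
  exact finrank_Kr_w_Dm_add K hM k q

/-- subtraction form: **`dim (Kr K univ (w K N N q) k ⊓ Sp K (pairs ⊆ T)) = C(2|T|, k) − C(|T|, k) · rank (hankel1 K N k q)`.** -/
theorem finrank_Kr_w_inf_Sp_pairs_eq (T : Finset (Fin N)) (k : ℕ) (q : ℕ → K) :
    finrank K ↥(Kr K (Finset.univ : Finset (In N)) (w K N N q) k ⊓ Sp K (fun s : Finset (In N) => ∀ i ∈ s, pr i ∈ T))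
      = (T.card + T.card).choose k - T.card.choose k * (hankel1 K N k q).rank := by
  have h := finrank_Kr_w_inf_Sp_pairs_add K T k q
  omega

/-- for `|T| < k` every `k`-form on the pairs of `T` dies: **`dim (Kr K univ (w K N N q) k ⊓ Sp K (pairs ⊆ T)) = C(2|T|, k)`.** -/
theorem finrank_Kr_w_inf_Sp_pairs_of_card_lt {T : Finset (Fin N)} {k : ℕ} (hk : T.card < k) (q : ℕ → K) :
    finrank K ↥(Kr K (Finset.univ : Finset (In N)) (w K N N q) k ⊓ Sp K (fun s : Finset (In N) => ∀ i ∈ s, pr i ∈ T)) = (T.card + T.card).choose k := by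
  have h := finrank_Kr_w_inf_Sp_pairs_add K T k q
  rw [Nat.choose_eq_zero_of_lt hk, zero_mul, add_zero] at h
  exact h

end Summit.Ventures.HSemireg.Wedge.HankelOuter
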